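import Summits.AtomisticToContinuum.Crystallization.Theorems.ChargedEnergyGapAtlasLanded7
import Summits.AtomisticToContinuum.Crystallization.Theorems.ChargedEnergyGapZeroHiEnclosure
import HarnessLib

/-!
# ChargedEnergyGap · NODE 113S-7Z «ResidualZLo» — the residual of record with the zero zone REFINED (zeroBox ↦ zeroLoBox)

decomp-a2c · lens-3 (g98) · line 14231 (PricedLinkCensus r3, leaf (T¹ᶜ) `StencilChartLawQ 130 (1/6e7) 160 (3/100) (679/1000) (691/1000)`).
Pure bookkeeping over LANDED theorems; NO new mathematics, no Prop-valued defs, no `instance` / notation / `set_option`.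

113S-7 (`stencilChartLawQ_designate_of_residual7`, AtlasLanded7) reads: the seven undecided zone laws LAW⁺(B),
B ∈ [easyBox, transBox, bulkTightBox, overBox, floorTightBox, plateauBox, zeroBox], and the 180 residual atlas-leaf laws give (T¹ᶜ).
lens-5 g120's NODE 120 (tree `ChargedEnergyGapZeroZoneSplit`, `…ZeroConeCover`, `…PhiLogConcave`, `…ZeroHiEnclosure`) PROVES the high part of the
zero zone outright (`ZeroZone.zeroHiBoxLaw`: roof ≡ 0 for C ≥ 259/2) and assembles `ZeroZone.zeroBox_hzone_of_lo : LAW⁺(zeroLoBox) → LAW⁺(zeroBox)`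
(u = 1/60000000), where `ZeroZone.zeroLoBox = zeroBox ∩ {C ≤ 259/2}` = ⟨679/1000, 691/1000, 124513/1000, 1291605/10000, 124513/1000, 130691/1000,
49941/400, 259/2⟩ (architecture ADOPTED, STATUS r1936 (B) / lens-3 ADOPT line).

THIS FILE: `stencilChartLawQ_designate_of_residual7Z` — (T¹ᶜ) from the seven zone laws with `zeroBox` REPLACED by `ZeroZone.zeroLoBox`
(C-width 5.8385 → 4.6475; the station debt of the zone is its part below C = 259/2 only) and the same 180 residual atlas-leaf laws
(`atlasResidual7`). One `rcases` over the refined list; the zeroBox member is produced by `ZeroZone.zeroBox_hzone_of_lo`.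
-/

namespace Summit.AtomisticToContinuum.Crystallization.Theorems.ChargedEnergyGapChartDial

open scoped Classical
open Literature.MathematicalPhysics.StatisticalMechanics Literature.Geometry.DiscreteGeometry
open Summit.AtomisticToContinuum.Crystallization.Theses.PricedLinkCensus
open Summit.AtomisticToContinuum.Crystallization.Theorems.ChargedEnergyGapNegative

section Assembly

/-- in-file check: the refined zone box is the low C-part of `zeroBox` (same ρ, T₀-, F₀-floors and C-floor; C-ceiling 259/2; T₀-ceiling 259/2 − 679/2000). -/
example : ZeroZone.zeroLoBox.r0 = zeroBox.r0 ∧ ZeroZone.zeroLoBox.r1 = zeroBox.r1 ∧ ZeroZone.zeroLoBox.t0 = zeroBox.t0 ∧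
    ZeroZone.zeroLoBox.f0 = zeroBox.f0 ∧ ZeroZone.zeroLoBox.f1 = zeroBox.f1 ∧ ZeroZone.zeroLoBox.c0 = zeroBox.c0 ∧
    ZeroZone.zeroLoBox.c1 = 259 / 2 ∧ ZeroZone.zeroLoBox.t1 = 259 / 2 - 679 / 2000 ∧ ZeroZone.zeroLoBox.c1 < zeroBox.c1 := by
  decide +kernel

/-- ★★★ **(T¹ᶜ) FROM THE RESIDUAL OF RECORD, ZERO ZONE REFINED**: the seven undecided zone laws with `zeroBox ↦ ZeroZone.zeroLoBox`
(the high part `C ≥ 259/2` is the tree theorem `ZeroZone.zeroHiBoxLaw`) and the 180 residual unit-box laws give the designate of 14231. -/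
theorem stencilChartLawQ_designate_of_residual7Z
    (hzones : ∀ B ∈ [easyBox, transBox, bulkTightBox, overBox, floorTightBox, plateauBox, ZeroZone.zeroLoBox],
      ∀ ρ : ℝ, (B.r0 : ℝ) ≤ ρ → ρ ≤ B.r1 → ∀ dt : (Fin 3 → ℤ) → ℝ,
      (B.t0 : ℝ) ≤ dt (holeVertex 0 (0, true)) → dt (holeVertex 0 (0, true)) ≤ B.t1 →
      (B.f0 : ℝ) ≤ dt (holeVertex 0 (0, false)) → dt (holeVertex 0 (0, false)) ≤ B.f1 → (B.c0 : ℝ) ≤ dt 0 → dt 0 ≤ B.c1 →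
      IsChartRealisable ρ dt → (∀ p ∈ stencil 0, 0 < dt p) → poleSum dt 0 ≤ poleSum dt 1 → poleSum dt 0 ≤ poleSum dt 2 →
      (∀ a : Fin 3, dt (holeVertex 0 (a, true)) ≤ dt (holeVertex 0 (a, false))) → IsTupleHole ((130 : ℚ) : ℝ) ρ dt →
      feetHoleCost 160 (3 / 100) ρ dt 0 ≤ domCapK ((1 / 60000000 : ℚ) : ℝ) 160 (3 / 100) ρ (chargeDepth ρ dt 0))
    (hrest : ∀ B ∈ atlasResidual7, ∀ ρ : ℝ, (B.r0 : ℝ) ≤ ρ → ρ ≤ B.r1 → ∀ dt : (Fin 3 → ℤ) → ℝ,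
      (B.t0 : ℝ) ≤ dt (holeVertex 0 (0, true)) → dt (holeVertex 0 (0, true)) ≤ B.t1 →
      (B.f0 : ℝ) ≤ dt (holeVertex 0 (0, false)) → dt (holeVertex 0 (0, false)) ≤ B.f1 → (B.c0 : ℝ) ≤ dt 0 → dt 0 ≤ B.c1 →
      IsChartRealisable ρ dt → (∀ p ∈ stencil 0, 0 < dt p) → poleSum dt 0 ≤ poleSum dt 1 → poleSum dt 0 ≤ poleSum dt 2 →
      (∀ a : Fin 3, dt (holeVertex 0 (a, true)) ≤ dt (holeVertex 0 (a, false))) → IsTupleHole ((130 : ℚ) : ℝ) ρ dt →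
      feetHoleCost 160 (3 / 100) ρ dt 0 ≤ domCapK ((1 / 60000000 : ℚ) : ℝ) 160 (3 / 100) ρ (chargeDepth ρ dt 0)) :
    StencilChartLawQ 130 (1 / 60000000) 160 (3 / 100) (679 / 1000) (691 / 1000) :=
  stencilChartLawQ_designate_of_residual7 (by
    intro B hB
    simp only [List.mem_cons, List.mem_nil_iff, or_false] at hB
    rcases hB with rfl | rfl | rfl | rfl | rfl | rfl | rfl
    · exact hzones _ (by simp)
    · exact hzones _ (by simp)
    · exact hzones _ (by simp)
    · exact hzones _ (by simp)
    · exact hzones _ (by simp)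
    · exact hzones _ (by simp)
    · exact ZeroZone.zeroBox_hzone_of_lo (hzones _ (by simp))) hrest

/-- MUST-FAIL-shaped negative twin (kernel): the refined list is a GENUINE refinement — `zeroLoBox` does not cover `zeroBox`
(113P `GBox.covers`), so the zeroBox member is not available from `hzones` by monotonicity alone; it needs NODE 120. -/
example : ZeroZone.zeroLoBox.covers zeroBox = false := by decide +kernel

end Assembly

end Summit.AtomisticToContinuum.Crystallization.Theorems.ChargedEnergyGapChartDial
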